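import Literature.MathematicalPhysics.QuantumFieldTheory.Balaban1983to89.B15Eq112TorusCover
import Literature.MathematicalPhysics.QuantumFieldTheory.Balaban1983to89.B6SectADomainsV1
import Literature.MathematicalPhysics.QuantumFieldTheory.Balaban1983to89.B5Eq118OneStroke
import Literature.MathematicalPhysics.QuantumLattice.BalabanRG

/-!
# NODE 00 — THE TORUS→`ℤᵈ` TWIN, FILE 38: the universal cover AT EVERY LEVEL `j` of the tower `T^{(j)}` and its
# INTERTWINING with the block maps — `blockOf ∘ π_j = π_{j+1} ∘ ⌊·∕L⌋`, `B^j`-blocks of the torus = images of the `ℤᵈ`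
# blocks `blockSites (L^j)`, the iterated site average `Q′_j` read on the cover, and the rows «`μ ∘ π` vanishes on `Λ₀`,
# its `L^j`-block sums vanish on `Λ_j`» of the (153) test-function form from `N(Q′)` of [B6] (2.7)∕(2.10)

Cell `pub-ymgap`, seat `pub-ymgap-dag-n07-e` generation 18 (R141 (C) s3 lineage «torus-vs-box twin», DAG node N07 = [15]; INTENT-38, bus
2026-08-28).  NEW leaf; CONSUMED BY NAME, nothing modified: r15's `B15Eq112TorusCover.cover` (the level-`0` cover `π : ℤᵈ → T_η`), `Setup`'s
`Site ∕ blockOf ∕ emb ∕ Params.sitesPerDir`, `TorusGeometry`'s `Site.val_blockOf ∕ Site.val_emb ∕ Params.sitesPerDir_eq_mul_succ`, p21's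
`B5Eq118OneStroke.(iterBlockOf, iterBlock, mem_iterBlock, card_iterBlock, siteAvgIter_eq_blockSum)` ((1.18)–(1.20)), p21's
`B6SectADomainsV1.Domains` ((2.1)–(2.3), `LamSite`, `InGauge` = `N(Q′)` (2.7)∕(2.10)), and the cell-wide `ℤᵈ` block vocabulary
`QuantumLattice.(blockMap, blockSites, mem_blockSites_iff, card_blockSites)`.
[15] = [Balaban1985Variational]; [6] = [Balaban1985RegularSpaces]; [B5] = [Balaban1984PropagatorsI]; [B6] = [Balaban1984PropagatorsII]; [I] = [Balaban1987RG1].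

WHY.  [15] (153) «`R ∂^{η*}A = 0`, where the operator `R` is defined for the sequence `{Ω″_j}`» is the averaging-adapted Landau gauge of [6] (1.31)∕(1.38),
in [B6]'s test-function form (2.12) «`⟨Δμ, ∂*A⟩ = 0` for every `μ ∈ N(Q′)`», `N(Q′) = {μ : μ = 0 on Λ₀, Q′_jμ = 0 on Λ_j}` ((2.7)∕(2.10)).  The K0 road
carries (153) from N05's `ℤᵈ` member through the cover (`Node00.TorusCoverLandau153*`, seat n07-w3): its torus-side theorem
`sum_laplace_mul_diverg_eq_zero_of_isLandau138_cover` displays, for the torus test function `μ`, the rows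
«(h0) `μ (π x) = 0` for `x ∈ Λs 0`» and «(hQ) `Σ_{x ∈ blockSites (L^j) y} 𝟙_X(x)·μ(π x) = 0` for `y ∈ Λs j`, `1 ≤ j`» in `ℤᵈ` BLOCK letters, while the
consumer's test functions are given as members of `N(Q′)` of a TORUS domain family `D : B6SectADomainsV1.Domains P` (`D.InGauge μ`: `Q′_jμ(y′) = 0` on
`D.LamSite j`, `y′ : Site P j`) — the route UnitScaleTilt's flat operators, k0-s1's ports and this lineage's module 37 are all keyed on that object.
The junction between the two is the LEVEL-`j` COVER `π_j : ℤᵈ → T^{(j)}` (`coverAt P j`, the cover of the `j`-th torus of the tower in its own labels) and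
its intertwining with the block maps of `Setup`: `blockOf (π_j x) = π_{j+1} ⌊x∕L⌋` (§2), hence `iterBlockOf j (π x) = π_j ⌊x∕L^j⌋`, hence «the `ℤᵈ` block
`blockSites (L^j) y` maps bijectively onto the torus block `B^j(π_j y)`» (§3), hence «`Q′_jμ(π_j y) = L^{−dj} Σ_{blockSites (L^j) y} μ ∘ π`» by the one-stroke
formula (1.20) (§4), hence the rows (§5).  n07-w3 g2's HANDOFF names exactly this («needs a LEVEL-j cover ∕ the intertwining `blockOf^j (cover x) =
cover_j (blockMap (L^j) x)` (not in tree)»).  The SPECIFIC identification of the `ℤᵈ` datum's `Λs j` with the `Λ_j` of the (144) cube tower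
(`FlatCubeSequenceAligned.cubeSeqM`) is geometry of that pair and is NOT done here: §5 displays it as the one hypothesis `y ∈ Λs j → D.LamSite j (π_j y)`
(and offers the canonical `ℤᵈ` shadow `lamShadow D j = π_j⁻¹(Λ_j)` for which it is `Iff.rfl`).

WHAT IS PROVED (kernel; every `Params`; standing range `j ≤ m + K` where the block maps are the printed ones; NO estimate of Bałaban — integer ∕ torus
bookkeeping and (1.20) by name).
§1 `coverAt P j` (`x ↦ (x_μ mod 2L^{m+K−j})_μ`), `coverAt_zero` (`= cover P`, `rfl`), `val_coverAt`, `coverAt_eq_coverAt_iff` (fibres = congruence classes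
   modulo `sitesPerDir j`), `coverAt_add_period` (deck invariance), `coverAt_valLift` ∕ `coverAt_surjective`.
§2 `zmod_val_div_eq_ediv` (the residue arithmetic `(a mod S₁L) div L ≡ a div L (mod S₁)`), ★ `blockOf_coverAt`, `blockMap_blockMap` (`⌊⌊x∕N⌋∕L⌋ = ⌊x∕(NL)⌋`),
   ★★ `iterBlockOf_cover`, `emb_coverAt` (the centre embedding under the cover: `emb (π_{j+1} y) = π_j (L·y + (L−1)∕2)`), `embIter_coverAt`
   (`embIter j (π_j y) = π (L^j·y + (L^j−1)∕2)`).
§3 ★ `injOn_cover_blockSites` (`π` is injective on every `blockSites (L^j) y`, `j ≤ m+K`: its side `L^j ≤ L^{m+K} < 2L^{m+K}`),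
   `cover_mem_iterBlock_of_mem_blockSites`, ★★ `image_cover_blockSites` (`π '' blockSites (L^j) y = B^j(π_j y)`), ★ `sum_blockSites_comp_cover`.
§4 ★★ `siteAvgIter_coverAt` (`Q′_jμ(π_j y) = ((L^d)^j)⁻¹ • Σ_{x ∈ blockSites (L^j) y} μ(π x)`), ★★ `sum_blockSites_cover_eq_zero_of_inGauge`
   (`μ ∈ N(Q′)`, `π_j y ∈ Λ_j` ⇒ the block sum vanishes), `apply_cover_eq_zero_of_inGauge` (level `0`: `π x ∈ Λ₀ ⇒ μ(π x) = 0`),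
   `sum_blockSites_indicator_cover_eq_zero_of_inGauge` (with a window `X ⊇` the block, n07-w3's indicator letter).
§5 ★★★ `rows153_h0_of_inGauge` ∕ `rows153_hQ_of_inGauge` — n07-w3's rows LETTER FOR LETTER from `D.InGauge μ` and the displayed identification;
   `lamShadow`, `mem_lamShadow`, `rows153_hQ_lamShadow`.
HONEST FRAMING: definitions (`coverAt`, `lamShadow`) and lattice-geometric bookkeeping only — nothing of Bałaban asserted or discharged; N07 ∕ N05 ∕ K0⁷ NOT
discharged; stub 1 NOT closed; counts unmoved (5∕27); one finite T⁴ programme at fixed ε — NOT continuum ∕ ℝ⁴ ∕ infinite volume ∕ OS ∕ mass gap ∕ Clay.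
No `sorry`, no `instance`, no `notation`.
-/

noncomputable section

namespace Literature.MathematicalPhysics.QuantumFieldTheory.Balaban1983to89.Node00

open B15Eq112TorusCover (cover cover_apply)
open B14DomainGeom (Pt)
open B5Eq118OneStroke (iterBlockOf iterBlock mem_iterBlock card_iterBlock siteAvgIter_eq_blockSum iterBlockOf_zero iterBlockOf_succ)
open LatticeFieldCalculus (siteAvgIter)
open B15DeterminingSets (embIter)
open Literature.MathematicalPhysics.QuantumLattice (blockMap blockSites mem_blockSites_iff card_blockSites)

variable {P : Params}

/-! ## §1  The universal cover of the level-`j` torus `T^{(j)}` -/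

section CoverAt

variable (P) in
/-- **The universal cover of the `j`-th torus of the tower**, `π_j : ℤᵈ → T^{(j)} = Site P j`, `x ↦ (x_μ mod 2L^{m+K−j})_μ` — the level-`j` lattice
`T^{(j)}_{L^jη}` of [I] p. 251 («Each lattice determines a lattice of centers of these cubes») in ITS OWN integer labels (`Setup.Site P j`); at `j = 0`
this is r15's `B15Eq112TorusCover.cover` (`coverAt_zero`). [cite: Balaban1987RG1, (0.1) p.251] -/
def coverAt (j : ℕ) (x : Pt P.d) : Site P j := fun μ => ((x μ : ℤ) : ZMod (P.sitesPerDir j))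

/-- Coordinates of `π_j`. [cite: Balaban1987RG1, (0.1) p.251] -/
@[simp] theorem coverAt_apply (j : ℕ) (x : Pt P.d) (μ : Fin P.d) : coverAt P j x μ = ((x μ : ℤ) : ZMod (P.sitesPerDir j)) := rfl

/-- `π_0 = π`: at the finest level the level cover is r15's universal cover of `T_η`. [cite: Balaban1987RG1, (0.1) p.251] -/
theorem coverAt_zero : coverAt P 0 = cover P := rfl

/-- The residue coordinates of `π_j x`. [cite: Balaban1987RG1, (0.1) p.251] -/
theorem val_coverAt (j : ℕ) (x : Pt P.d) (μ : Fin P.d) : ((coverAt P j x μ).val : ℤ) = x μ % (P.sitesPerDir j : ℕ) :=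
  ZMod.val_intCast _

/-- **The fibres of `π_j` are the congruence classes modulo the site count** `sitesPerDir j = 2L^{m+K−j}`. [cite: Balaban1987RG1, (0.1) p.251] -/
theorem coverAt_eq_coverAt_iff (j : ℕ) (x y : Pt P.d) :
    coverAt P j x = coverAt P j y ↔ ∀ μ, ((P.sitesPerDir j : ℕ) : ℤ) ∣ y μ - x μ := by
  constructor
  · intro h μ
    exact (ZMod.intCast_eq_intCast_iff_dvd_sub (x μ) (y μ) _).1 (congrFun h μ)
  · intro h
    funext μ
    exact (ZMod.intCast_eq_intCast_iff_dvd_sub (x μ) (y μ) _).2 (h μ)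

/-- **Deck invariance** of `π_j`: translating by a multiple of the period in every direction does not change the image. [cite: Balaban1987RG1, (0.1) p.251] -/
theorem coverAt_add_period (j : ℕ) (x v : Pt P.d) :
    coverAt P j (x + fun μ => ((P.sitesPerDir j : ℕ) : ℤ) * v μ) = coverAt P j x := by
  rw [coverAt_eq_coverAt_iff]
  intro μ
  exact ⟨-v μ, by simp only [Pi.add_apply]; ring⟩

/-- A section of `π_j`: the label vector of a site. [cite: Balaban1987RG1, (0.1) p.251] -/
theorem coverAt_valLift (j : ℕ) (y : Site P j) : coverAt P j (fun μ => ((y μ).val : ℤ)) = y := by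
  funext μ
  simp

/-- `π_j` is onto. [cite: Balaban1987RG1, (0.1) p.251] -/
theorem coverAt_surjective (j : ℕ) : Function.Surjective (coverAt P j) := fun y => ⟨_, coverAt_valLift j y⟩

end CoverAt

/-! ## §2  The intertwining with the block maps: `blockOf ∘ π_j = π_{j+1} ∘ ⌊·∕L⌋` -/

section Intertwining

/-- Residue arithmetic behind the intertwining: for `S = S₁·L`, `0 < L`, the block label `(a mod S) div L` of a wrapped coordinate is the wrapped block
label `(a div L) mod S₁`. [folklore] -/
private theorem zmod_val_div_eq_ediv (S S₁ L : ℕ) [NeZero S] [NeZero S₁] (hS : (S : ℤ) = S₁ * L) (hL : (0 : ℤ) < L) (a : ℤ) :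
    (((ZMod.val ((a : ℤ) : ZMod S)) / L : ℕ) : ZMod S₁) = ((a / (L : ℤ) : ℤ) : ZMod S₁) := by
  -- adapted from the run-ladder lemma of the cell's N18 two-run dictionary (same arithmetic, one run)
  have hv : ((ZMod.val ((a : ℤ) : ZMod S) : ℕ) : ℤ) = a % S := ZMod.val_intCast a
  have hcast : (((ZMod.val ((a : ℤ) : ZMod S)) / L : ℕ) : ZMod S₁) = ((((ZMod.val ((a : ℤ) : ZMod S)) / L : ℕ) : ℤ) : ZMod S₁) :=
    (Int.cast_natCast _).symm
  rw [hcast, Int.natCast_div, hv, ZMod.intCast_eq_intCast_iff_dvd_sub, Int.emod_def, hS,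
    show a - (S₁ : ℤ) * L * (a / ((S₁ : ℤ) * L)) = a + L * (-((S₁ : ℤ) * (a / ((S₁ : ℤ) * L)))) by ring,
    Int.add_mul_ediv_left _ _ hL.ne']
  exact ⟨a / ((S₁ : ℤ) * L), by ring⟩

/-- ★ **THE ONE-LEVEL INTERTWINING** `blockOf (π_j x) = π_{j+1} ⌊x∕L⌋` (standing range `j + 1 ≤ m + K`): the block map of `Setup` (B12's centred blocks,
integer division of labels by `L`) is, read on the covers, the coordinatewise floor division `blockMap L` of the cell's `ℤᵈ` vocabulary.
[cite: Balaban1987RG1, (0.1)–(0.3) pp.251–252] -/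
theorem blockOf_coverAt {j : ℕ} (hj : j + 1 ≤ P.m + P.K) (x : Pt P.d) :
    blockOf (coverAt P j x) = coverAt P (j + 1) (blockMap P.L x) := by
  funext μ
  show (((ZMod.val (((x μ : ℤ)) : ZMod (P.sitesPerDir j))) / P.L : ℕ) : ZMod (P.sitesPerDir (j + 1))) =
    (((x μ / (P.L : ℤ) : ℤ)) : ZMod (P.sitesPerDir (j + 1)))
  have hS : ((P.sitesPerDir j : ℕ) : ℤ) = (P.sitesPerDir (j + 1) : ℕ) * (P.L : ℤ) := by
    rw [P.sitesPerDir_eq_mul_succ hj]; push_cast; ring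
  exact zmod_val_div_eq_ediv _ _ _ hS (by exact_mod_cast P.L_pos) _

/-- `⌊⌊x∕N⌋∕L⌋ = ⌊x∕(N·L)⌋` coordinatewise: two floor divisions compose — [B5] (1.16) «`Q₂` is defined as `Q` only with the number `L` replaced by `L²`»
(the blocks of blocks are the blocks of side `N·L`). [cite: Balaban1984PropagatorsI, (1.16) p.20] -/
theorem blockMap_blockMap (N L : ℕ) (x : Pt P.d) : blockMap L (blockMap N x) = blockMap (N * L) x := by
  funext i
  simp only [blockMap]
  push_cast
  exact Int.ediv_ediv_of_nonneg (by positivity)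

/-- ★★ **THE `j`-FOLD INTERTWINING** `iterBlockOf j (π x) = π_j ⌊x∕L^j⌋` (standing range `j ≤ m + K`): the `j`-fold block point of a covered fine site is the
level-`j` cover of its `L^j`-block label — [B5] (1.6)∕(1.18) «`x ∈ B^k(y)`» read on the universal cover. [cite: Balaban1984PropagatorsI, (1.18) p.20; Balaban1987RG1, (0.1) p.251] -/
theorem iterBlockOf_cover : ∀ {j : ℕ}, j ≤ P.m + P.K → ∀ x : Pt P.d, iterBlockOf j (cover P x) = coverAt P j (blockMap (P.L ^ j) x)
  | 0, _, x => by
    rw [iterBlockOf_zero, pow_zero]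
    funext μ
    simp
  | j + 1, hj, x => by
    rw [iterBlockOf_succ, iterBlockOf_cover (by omega) x, blockOf_coverAt hj, blockMap_blockMap, pow_succ]

/-- **THE CENTRE EMBEDDING UNDER THE COVER**: `emb (π_{j+1} y) = π_j (L·y + (L−1)∕2)` (standing range) — the coarse site `y` IS the fine site at the centre of
its block (B12 p. 251; `Setup.emb`, `L` odd). [cite: Balaban1987RG1, (0.1) p.251] -/
theorem emb_coverAt {j : ℕ} (hj : j + 1 ≤ P.m + P.K) (y : Pt P.d) :
    emb (coverAt P (j + 1) y) = coverAt P j (fun μ => (P.L : ℤ) * y μ + ((P.L - 1) / 2 : ℕ)) := by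
  funext μ
  simp only [emb, coverAt_apply]
  rw [← Int.cast_natCast, ZMod.intCast_eq_intCast_iff_dvd_sub]
  refine ⟨y μ / (P.sitesPerDir (j + 1) : ℕ), ?_⟩
  push_cast
  rw [ZMod.val_intCast, P.sitesPerDir_eq_mul_succ hj]
  push_cast
  have h := Int.emod_add_mul_ediv (y μ) (P.sitesPerDir (j + 1) : ℕ)
  linear_combination (-(P.L : ℤ)) * h

/-- `L^j · (L − 1)∕2 + (L^j − 1)∕2 = (L^{j+1} − 1)∕2` for odd `L` (exact halves): the centre offsets of the tower compose. [folklore] -/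
private theorem pow_mul_half_pred_add_half_pow_pred {L : ℕ} (hL : Odd L) (j : ℕ) :
    L ^ j * ((L - 1) / 2) + (L ^ j - 1) / 2 = (L ^ (j + 1) - 1) / 2 := by
  obtain ⟨l, rfl⟩ := hL
  obtain ⟨a, ha⟩ : Odd ((2 * l + 1) ^ j) := Odd.pow ⟨l, rfl⟩
  rw [pow_succ, ha]
  have h1 : (2 * a + 1 - 1) / 2 = a := by omega
  have h2 : (2 * l + 1 - 1) / 2 = l := by omega
  rw [h1, h2]
  have h3 : (2 * a + 1) * (2 * l + 1) - 1 = 2 * (2 * a * l + a + l) := by ring_nf; omega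
  rw [h3, Nat.mul_div_cancel_left _ (by norm_num)]
  ring

/-- **THE ITERATED CENTRE EMBEDDING UNDER THE COVER**: `embIter j (π_j y) = π (L^j·y + (L^j − 1)∕2)` (standing range) — the site of `T^{(j)}` with label `y`
IS the fine site at the centre of its `L^j`-block ([I] p. 251 «lattice of centers»; r12's `B15DeterminingSets.embIter`). [cite: Balaban1987RG1, (0.1) p.251] -/
theorem embIter_coverAt : ∀ {j : ℕ}, j ≤ P.m + P.K → ∀ y : Pt P.d,
    embIter j (coverAt P j y) = cover P (fun μ => (P.L : ℤ) ^ j * y μ + ((P.L ^ j - 1) / 2 : ℕ))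
  | 0, _, y => by
    show coverAt P 0 y = cover P _
    rw [coverAt_zero]
    congr 1
    funext μ
    simp
  | j + 1, hj, y => by
    show embIter j (emb (coverAt P (j + 1) y)) = _
    rw [emb_coverAt hj, embIter_coverAt (by omega)]
    congr 1
    funext μ
    have h := pow_mul_half_pred_add_half_pow_pred P.hL.1 j
    have h' : ((P.L : ℤ) ^ j * ((P.L - 1) / 2 : ℕ) + ((P.L ^ j - 1) / 2 : ℕ) : ℤ) = ((P.L ^ (j + 1) - 1) / 2 : ℕ) := by
      exact_mod_cast h
    rw [← h']
    ring

end Intertwining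

/-! ## §3  Blocks: `π` maps the `ℤᵈ` block `blockSites (L^j) y` bijectively onto the torus block `B^j(π_j y)` -/

section Blocks

/-- `0 < L^j`. [folklore] -/
private theorem pow_L_pos (j : ℕ) : 0 < P.L ^ j := pow_pos P.L_pos j

/-- `NeZero (L^j)` (for the cell's `mem_blockSites_iff`). [folklore] -/
private theorem neZero_pow_L (j : ℕ) : NeZero (P.L ^ j) := ⟨(pow_L_pos j).ne'⟩

/-- The side of a level-`j` block is below the fine period: `L^j < 2L^{m+K} = sitesPerDir 0` for `j ≤ m + K`. [folklore] -/
private theorem pow_lt_sitesPerDir_zero {j : ℕ} (hj : j ≤ P.m + P.K) : ((P.L ^ j : ℕ) : ℤ) < (P.sitesPerDir 0 : ℕ) := by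
  have h1 : P.L ^ j ≤ P.L ^ (P.m + P.K) := Nat.pow_le_pow_right P.L_pos hj
  have h2 : 0 < P.L ^ (P.m + P.K) := pow_pos P.L_pos _
  have h3 : P.sitesPerDir 0 = 2 * P.L ^ (P.m + P.K) := by simp [Params.sitesPerDir]
  rw [h3]; push_cast; exact_mod_cast (show P.L ^ j < 2 * P.L ^ (P.m + P.K) by omega)

/-- ★ **`π` IS INJECTIVE ON EVERY LEVEL-`j` BLOCK** `blockSites (L^j) y ⊂ ℤᵈ` (standing range `j ≤ m + K`): two points of the block differ by less than
`L^j < 2L^{m+K}` in every coordinate, so they are not congruent modulo the period unless equal. [cite: Balaban1987RG1, (0.1) p.251] -/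
theorem injOn_cover_blockSites {j : ℕ} (hj : j ≤ P.m + P.K) (y : Pt P.d) : Set.InjOn (cover P) ↑(blockSites (P.L ^ j) y) := by
  haveI := neZero_pow_L (P := P) j
  intro x hx x' hx' h
  rw [Finset.mem_coe, mem_blockSites_iff] at hx hx'
  have hS := pow_lt_sitesPerDir_zero hj
  funext i
  have hdvd : ((P.sitesPerDir 0 : ℕ) : ℤ) ∣ x' i - x i :=
    (ZMod.intCast_eq_intCast_iff_dvd_sub (x i) (x' i) _).1 (congrFun h i)
  have hxi := congrFun hx i
  have hxi' := congrFun hx' i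
  simp only [blockMap] at hxi hxi'
  have hN : (0 : ℤ) < (P.L ^ j : ℕ) := by exact_mod_cast pow_L_pos j
  -- both coordinates lie in `[N·y i, N·y i + N)`
  have h1 := Int.emod_add_mul_ediv (x i) (P.L ^ j : ℕ)
  have h2 := Int.emod_add_mul_ediv (x' i) (P.L ^ j : ℕ)
  have h3 := Int.emod_nonneg (x i) hN.ne'
  have h4 := Int.emod_lt_of_pos (x i) hN
  have h5 := Int.emod_nonneg (x' i) hN.ne'
  have h6 := Int.emod_lt_of_pos (x' i) hN
  rw [hxi] at h1; rw [hxi'] at h2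
  have habs : |x' i - x i| < (P.sitesPerDir 0 : ℕ) := by
    rw [abs_lt]; constructor <;> linarith
  have := Int.eq_zero_of_abs_lt_dvd hdvd habs
  linarith

/-- A point of the `ℤᵈ` block `blockSites (L^j) y` covers a point of the torus block `B^j(π_j y)`. [cite: Balaban1984PropagatorsI, (1.18) p.20] -/
theorem cover_mem_iterBlock_of_mem_blockSites {j : ℕ} (hj : j ≤ P.m + P.K) {y x : Pt P.d} (hx : x ∈ blockSites (P.L ^ j) y) :
    cover P x ∈ iterBlock j (coverAt P j y) := by
  haveI := neZero_pow_L (P := P) j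
  rw [mem_iterBlock, iterBlockOf_cover hj, (mem_blockSites_iff _ _ _).1 hx]

/-- ★★ **THE `ℤᵈ` BLOCK COVERS THE TORUS BLOCK EXACTLY**: `π '' blockSites (L^j) y = B^j(π_j y)` (standing range) — both have `L^{jd}` points and `π` is
injective on the former. [cite: Balaban1984PropagatorsI, (1.18) p.20; Balaban1987RG1, (0.1) p.251] -/
theorem image_cover_blockSites {j : ℕ} (hj : j ≤ P.m + P.K) (y : Pt P.d) :
    (blockSites (P.L ^ j) y).image (cover P) = iterBlock j (coverAt P j y) := by
  apply Finset.eq_of_subset_of_card_le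
  · intro x' hx'
    obtain ⟨x, hx, rfl⟩ := Finset.mem_image.1 hx'
    exact cover_mem_iterBlock_of_mem_blockSites hj hx
  · rw [Finset.card_image_of_injOn (injOn_cover_blockSites hj y), card_blockSites, card_iterBlock j hj, ← pow_mul, ← pow_mul, mul_comm]

/-- ★ **`ℤᵈ` BLOCK SUMS ARE TORUS BLOCK SUMS**: `Σ_{x ∈ blockSites (L^j) y} f(π x) = Σ_{x′ ∈ B^j(π_j y)} f x′` (standing range).
[cite: Balaban1984PropagatorsI, (1.20) p.20] -/
theorem sum_blockSites_comp_cover {M : Type*} [AddCommMonoid M] {j : ℕ} (hj : j ≤ P.m + P.K) (y : Pt P.d) (f : Site P 0 → M) :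
    ∑ x ∈ blockSites (P.L ^ j) y, f (cover P x) = ∑ x' ∈ iterBlock j (coverAt P j y), f x' := by
  rw [← image_cover_blockSites hj y, Finset.sum_image (injOn_cover_blockSites hj y)]

end Blocks

/-! ## §4  The iterated site average `Q′_j` read on the cover; `N(Q′)` kills the block sums -/

section Averages

variable {V : Type*} [AddCommGroup V] [Module ℝ V]

/-- ★★ **`Q′_j` ON THE COVER**: `(Q′_jμ)(π_j y) = ((L^d)^j)⁻¹ • Σ_{x ∈ blockSites (L^j) y} μ(π x)` (standing range) — [B5] (1.20) «`(Q′_kλ)(y) = Σ_{x∈B^k(y)} η^d λ(x)`»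
with the torus block replaced by its `ℤᵈ` lift. [cite: Balaban1984PropagatorsI, (1.20) p.20] -/
theorem siteAvgIter_coverAt {j : ℕ} (hj : j ≤ P.m + P.K) (μ : SiteField P 0 V) (y : Pt P.d) :
    siteAvgIter j μ (coverAt P j y) = ((((P.L : ℝ) ^ P.d) ^ j)⁻¹) • ∑ x ∈ blockSites (P.L ^ j) y, μ (cover P x) := by
  rw [siteAvgIter_eq_blockSum j hj μ, sum_blockSites_comp_cover hj y]

/-- ★★ **`N(Q′)` KILLS THE `ℤᵈ` BLOCK SUMS ON `Λ_j`**: for `μ ∈ N(Q′)` of the nested family `D` ([B6] (2.7)∕(2.10), `D.InGauge μ`) and a `ℤᵈ` label `y` whose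
level-`j` cover lies in `Λ_j` (`D.LamSite j (π_j y)`), `Σ_{x ∈ blockSites (L^j) y} μ(π x) = 0`. [cite: Balaban1984PropagatorsII, (2.7) p.224, (2.10) p.225] -/
theorem sum_blockSites_cover_eq_zero_of_inGauge (D : B6SectADomainsV1.Domains P) {μ : SiteField P 0 ℝ}
    (hμ : D.InGauge μ) {j : ℕ} {y : Pt P.d} (hy : D.LamSite j (coverAt P j y)) :
    ∑ x ∈ blockSites (P.L ^ j) y, μ (cover P x) = 0 := by
  have hj : j ≤ P.m + P.K := (D.le_of_lamSite hy).trans D.hk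
  have h := hμ j _ hy
  rw [siteAvgIter_coverAt hj, smul_eq_zero] at h
  rcases h with h | h
  · exact absurd h (inv_ne_zero (pow_ne_zero _ (pow_ne_zero _ (Nat.cast_ne_zero.2 P.L_pos.ne'))))
  · exact h

/-- **Level `0`**: for `μ ∈ N(Q′)` and a fine point `x` with `π x ∈ Λ₀ = Ω₁ᶜ`, `μ(π x) = 0` ([B6] (2.7) «`λ = 0` on `Λ₀`»).
[cite: Balaban1984PropagatorsII, (2.7) p.224] -/
theorem apply_cover_eq_zero_of_inGauge (D : B6SectADomainsV1.Domains P) {μ : SiteField P 0 ℝ}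
    (hμ : D.InGauge μ) {x : Pt P.d} (hx : D.LamSite 0 (cover P x)) : μ (cover P x) = 0 := by
  simpa [siteAvgIter] using hμ 0 _ hx

/-- The indicator letter of n07-w3's row: for a window `X ⊇ blockSites (L^j) y` the cut-off block sum is the block sum (any summand `g`). [folklore] -/
private theorem sum_blockSites_indicator_of_subset {M : Type*} [AddCommMonoid M] {N : ℕ} {y : Pt P.d} {X : Set (Pt P.d)}
    (hX : ↑(blockSites N y) ⊆ X) (g : Pt P.d → M) :
    ∑ x ∈ blockSites N y, X.indicator g x = ∑ x ∈ blockSites N y, g x :=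
  Finset.sum_congr rfl fun _ hx => Set.indicator_of_mem (hX (Finset.mem_coe.2 hx)) g

/-- The cut-off block sum of `μ ∘ π` (as a complex number) vanishes for `μ ∈ N(Q′)`, `π_j y ∈ Λ_j`, `blockSites (L^j) y ⊆ X`.
[cite: Balaban1984PropagatorsII, (2.7) p.224, (2.10) p.225] -/
theorem sum_blockSites_indicator_cover_eq_zero_of_inGauge (D : B6SectADomainsV1.Domains P) {μ : SiteField P 0 ℝ}
    (hμ : D.InGauge μ) {j : ℕ} {y : Pt P.d} (hy : D.LamSite j (coverAt P j y)) {X : Set (Pt P.d)} (hX : ↑(blockSites (P.L ^ j) y) ⊆ X) :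
    ∑ x ∈ blockSites (P.L ^ j) y, X.indicator (fun z => ((μ (cover P z) : ℝ) : ℂ)) x = 0 := by
  rw [sum_blockSites_indicator_of_subset hX, ← Complex.ofReal_sum, sum_blockSites_cover_eq_zero_of_inGauge D hμ hy, Complex.ofReal_zero]

end Averages

/-! ## §5  The junction: the rows of the (153) test-function form from `N(Q′)` of a torus domain family -/

section Rows153

/-- **THE `ℤᵈ` SHADOW OF `Λ_j`**: the level-`j` labels `y ∈ ℤᵈ` whose cover `π_j y` lies in `Λ_j = Ω_j^{(j)} ∖ Ω_{j+1}^{(j)}` of the nested family `D`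
([B6] (2.3)) — the canonical `Λs` for which the identification hypothesis of the rows below is `Iff.rfl`. [cite: Balaban1984PropagatorsII, (2.3) p.224] -/
def lamShadow (D : B6SectADomainsV1.Domains P) (j : ℕ) : Set (Pt P.d) := {y | D.LamSite j (coverAt P j y)}

/-- Membership in the shadow (definitional). [cite: Balaban1984PropagatorsII, (2.3) p.224] -/
@[simp] theorem mem_lamShadow (D : B6SectADomainsV1.Domains P) (j : ℕ) (y : Pt P.d) : y ∈ lamShadow D j ↔ D.LamSite j (coverAt P j y) := Iff.rfl

/-- The shadow is empty above the top level `k` of the family. [cite: Balaban1984PropagatorsII, (2.3) p.224] -/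
theorem lamShadow_eq_empty_of_lt (D : B6SectADomainsV1.Domains P) {j : ℕ} (hj : D.k < j) : lamShadow D j = ∅ :=
  Set.eq_empty_iff_forall_notMem.2 fun _ hy => D.not_lamSite_of_lt hj _ hy

/-- ★★★ **ROW (h0) OF THE (153) TEST-FUNCTION FORM FROM `N(Q′)`**: if the `ℤᵈ` datum's level-`0` set `Λs 0` lies, on the window `X`, over `Λ₀ = Ω₁ᶜ` of the
torus family `D`, then every `μ ∈ N(Q′)` ([B6] (2.7)∕(2.10)) satisfies n07-w3's `h0 : ∀ x ∈ X, x ∈ Λs 0 → μ (cover P x) = 0` — the letter of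
`Node00.sum_laplace_mul_diverg_re_eq_zero_of_isLandau138_cover`. [cite: Balaban1984PropagatorsII, (2.7) p.224, (2.12) p.225; Balaban1985Variational, (153) p.301] -/
theorem rows153_h0_of_inGauge (D : B6SectADomainsV1.Domains P) {μ : Site P 0 → ℝ} (hμ : D.InGauge μ)
    {Λs : ℕ → Set (Pt P.d)} {X : Set (Pt P.d)} (hΛ0 : ∀ x ∈ X, x ∈ Λs 0 → D.LamSite 0 (cover P x)) :
    ∀ x ∈ X, x ∈ Λs 0 → μ (cover P x) = 0 :=
  fun x hx hx0 => apply_cover_eq_zero_of_inGauge D hμ (hΛ0 x hx hx0)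

/-- ★★★ **ROW (hQ) OF THE (153) TEST-FUNCTION FORM FROM `N(Q′)`** (real test function, n07-w3's indicator letter): if for `1 ≤ j ≤ m′` every `y ∈ Λs j`
has its level-`j` cover in `Λ_j` of `D` and its `ℤᵈ` block inside the window `X`, then every `μ ∈ N(Q′)` satisfies
`hQ : ∀ j, 1 ≤ j → j ≤ m′ → ∀ y ∈ Λs j, Σ_{x ∈ blockSites (L^j) y} 𝟙_X·(μ ∘ π) = 0` — the letter of `Node00.sum_laplace_mul_diverg_re_eq_zero_of_isLandau138_cover`.
[cite: Balaban1984PropagatorsII, (2.7) p.224, (2.12) p.225; Balaban1985Variational, (153) p.301] -/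
theorem rows153_hQ_of_inGauge (D : B6SectADomainsV1.Domains P) {μ : Site P 0 → ℝ} (hμ : D.InGauge μ)
    {Λs : ℕ → Set (Pt P.d)} {X : Set (Pt P.d)} {m' : ℕ}
    (hΛ : ∀ j, 1 ≤ j → j ≤ m' → ∀ y ∈ Λs j, D.LamSite j (coverAt P j y) ∧ ↑(blockSites (P.L ^ j) y) ⊆ X) :
    ∀ j, 1 ≤ j → j ≤ m' → ∀ y ∈ Λs j, ∑ x ∈ blockSites (P.L ^ j) y, X.indicator (fun z => μ (cover P z)) x = 0 := by
  intro j hj hjm y hy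
  obtain ⟨hyΛ, hyX⟩ := hΛ j hj hjm y hy
  rw [sum_blockSites_indicator_of_subset hyX]
  exact sum_blockSites_cover_eq_zero_of_inGauge D hμ hyΛ

/-- The same row for the COMPLEX-valued reading `z ↦ (μ (π z) : ℂ)` (the letter of n07-w3's `sum_laplace_mul_diverg_eq_zero_of_isLandau138_cover` at a real `μ`).
[cite: Balaban1984PropagatorsII, (2.7) p.224, (2.12) p.225; Balaban1985Variational, (153) p.301] -/
theorem rows153_hQ_of_inGauge_complex (D : B6SectADomainsV1.Domains P) {μ : Site P 0 → ℝ} (hμ : D.InGauge μ)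
    {Λs : ℕ → Set (Pt P.d)} {X : Set (Pt P.d)} {m' : ℕ}
    (hΛ : ∀ j, 1 ≤ j → j ≤ m' → ∀ y ∈ Λs j, D.LamSite j (coverAt P j y) ∧ ↑(blockSites (P.L ^ j) y) ⊆ X) :
    ∀ j, 1 ≤ j → j ≤ m' → ∀ y ∈ Λs j, ∑ x ∈ blockSites (P.L ^ j) y, X.indicator (fun z => ((μ (cover P z) : ℝ) : ℂ)) x = 0 := by
  intro j hj hjm y hy
  obtain ⟨hyΛ, hyX⟩ := hΛ j hj hjm y hy
  exact sum_blockSites_indicator_cover_eq_zero_of_inGauge D hμ hyΛ hyX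

/-- ★ **THE ROWS FOR THE CANONICAL SHADOW** `Λs := lamShadow D`: only the window condition «the `ℤᵈ` blocks of the shadow labels in use lie in `X`» remains.
[cite: Balaban1984PropagatorsII, (2.3) p.224, (2.7) p.224, (2.12) p.225] -/
theorem rows153_hQ_lamShadow (D : B6SectADomainsV1.Domains P) {μ : Site P 0 → ℝ} (hμ : D.InGauge μ) {X : Set (Pt P.d)} {m' : ℕ}
    (hX : ∀ j, 1 ≤ j → j ≤ m' → ∀ y ∈ lamShadow D j, ↑(blockSites (P.L ^ j) y) ⊆ X) :
    ∀ j, 1 ≤ j → j ≤ m' → ∀ y ∈ lamShadow D j, ∑ x ∈ blockSites (P.L ^ j) y, X.indicator (fun z => μ (cover P z)) x = 0 :=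
  rows153_hQ_of_inGauge D hμ fun j hj hjm y hy => ⟨hy, hX j hj hjm y hy⟩

/-- The level-`0` row for the canonical shadow holds with no window condition. [cite: Balaban1984PropagatorsII, (2.3) p.224, (2.7) p.224] -/
theorem rows153_h0_lamShadow (D : B6SectADomainsV1.Domains P) {μ : Site P 0 → ℝ} (hμ : D.InGauge μ) (X : Set (Pt P.d)) :
    ∀ x ∈ X, x ∈ lamShadow D 0 → μ (cover P x) = 0 :=
  rows153_h0_of_inGauge D hμ fun _ _ hx0 => hx0

end Rows153

end Literature.MathematicalPhysics.QuantumFieldTheory.Balaban1983to89.Node00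

end
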